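/-
Copyright (c) 2026 the pub-hodgecm-mathlib formalisation cell (harness21).  Prover seat hodgecm-mathlib-K2Liu-p26 (g0): Track B «K2-LIT»,
#184♮ = hLiu418 = stmt-HodgeConjecture-24832; Road Φ of socket #41, Φ9 consumer sheet row G3 «Φ5 BAD FINITE» at the Skew carrier (LEAD F0P6-plan (g14)
EMIT #1 SPARES S-a, BATCH #41∕#43; K2E5-plan (g7) desk note 14:59:12Z; census `K2/K2Liu-p26/g0/CENSUS-Sa-BadPlaceWhittakerSkewInstance.K2Liu-p26-g0.md`).
-/
import Summits.HodgeConjecture.HodgeConjecture.Theorems.K2LiuBadPlaceWhittakerEntire     -- ★ Φ5-tie (+ ★ F4b-2 Heads, ★ F4b-1 FarShells ⊇ ★ F4a Shells, ★ F3b SkewLatticeShells)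
import Summits.HodgeConjecture.HodgeConjecture.Theorems.K2LiuSkewBallVolumeGrowth        -- ★ `measure_ball_sub_le_pow_mul` (ball-volume growth on the Skew carrier)
import HarnessLib

/-!
# Crux `HLiu418`, Road Φ of socket #41 — row G3 «Φ5 BAD FINITE» AT THE SKEW CARRIER: the BOUND in ball-volume letters and the LATTICE SUPPORT
# of the bad-place local Whittaker ball integral `∫_{B(−k)} φ(t)·ψ(−τ tr(β t)) dμ(t)`

Cell `hodgecm-mathlib`, crux item hLiu418 = `stmt-HodgeConjecture-24832`, route of record `HCCMUnconditional`; squad K2 ∕ K2Liu, road `K2_Liu`,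
socket #41 `sig_K2LiuSiegelEisensteinContinuation`, Road Φ; Φ9 consumer sheet row G3 («`s ↦ W_{S,v}(f_v,s)(h_v)` ENTIRE; `‖·‖ ≤ C_v(K)` on compact `K`;
`= 0` unless `S ∈ Λ_v`»), read at the Skew carrier `S = Skew_{T₀}(E ⊗ F_v)` with the balls `B a = {t | ∀ i j w, |t_{ij,w}|_w ≤ |ι_w π|_w^a}` of ★ F3b
`K2LiuSkewLatticeShells`, the pulled-back section `φ(t) = f_s(w_Δ n(t))` and the character weight `χ(t) = ψ(−τ tr(β t))` (`ψ : AddChar F_v 𝕊¹`, `τ` the local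
trace, BOTH BY VALUE exactly as ★ B4 `K2LiuLocalWhittakerFactorSkew` and ★ Φ5-tie `K2LiuBadPlaceWhittakerEntire` spell them).  THEOREMS ONLY (no `def`, no
`instance`, no `notation`, no named-fact hypothesis, no `sorry`); lane `--supports stmt-HodgeConjecture-24832` (count-neutral helper; closes no socket by itself).

WHAT IS ★ ELSEWHERE (not restated): the ENTIRE clause and the BALL FORMULA are ★ Φ5-tie `whittaker_setIntegral_ball_eq` ∕ `whittaker_integral_eq_setIntegral_ball`
∕ `differentiable_whittaker`.  WHAT THIS FILE ADDS — the two remaining clauses of row G3 at the Skew carrier: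
* §1 **BOUND** [Shimura1997, §18], [Casselman1980, §3]: `norm_setIntegral_ball_mul_addChar_le` (★ F4b-2 `norm_setIntegral_ball_le` at `V = Skew`, `‖ψ‖ = 1`);
  the VOLUME LETTER in real numbers `measureReal_ball_sub_le_pow_mul` (`μ(B(a−K)) ≤ N_v^K·μ(B a)`, any radius `a`) ∕ `measureReal_ball_neg_le_pow_mul`
  (`μ(B(−k)) ≤ N_v^{k⁺}·μ(B 0)`), `N_v = ∏_{(i,j,w)} |ι_w π|_w⁻¹` VERBATIM from ★ `K2LiuSkewBallVolumeGrowth.measure_ball_sub_le_pow_mul` (`1 ≤ N_v < ∞`; ★ R2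
  `toReal_prod_inv_normAbs_toPlace_pow` converts `N_v^K` to `q_v^{2n²K}` for the CM datum); hence **`norm_setIntegral_ball_mul_addChar_le_pow_mul`**:
  `‖∫_{B(−k)} φ·ψ(−τ tr(β t)) dμ‖ ≤ C·N_v^{k⁺}·μ(B 0)`, and at the Φ5 truncation exponent `k = K₁ + 4b + 2b′ − 1` (`β ∈ ball(−b)`, `β⁻¹ ∈ ball(−b′)`) the
  (A-1) shape **`norm_setIntegral_ball_mul_addChar_le_of_exponent`**: `≤ C·N_v^{K₁⁺}·(N_v^4)^{b}·(N_v^2)^{b′}·μ(B 0)` — polynomial in `q_v^{b}, q_v^{b′}`, i.e. the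
  `|det β|_v^{−A}(1+‖β‖_v)^{A}` weight of M-156n (A-1) in valuation letters, `C` the local uniform bound of the section on the ball (the tie's `hbd`).
* §2 **LATTICE SUPPORT** [Casselman1980, §3], [Shimura1997, §18]: `setIntegral_ball_whittaker_eq_zero_of_translate` — if some `t₀ ∈ B(−k)` with `n(t₀) ∈ U` (the
  right-invariance group of `f`) has `ψ(−τ tr(β t₀)) ≠ 1`, then `∫_{B(−k)} f(w_Δ n(t))·ψ(−τ tr(β t)) dμ = 0` (★ F4a `setIntegral_eq_zero_of_unipotent_translate` with
  `χ = ψ(−τ tr(β·))`, `ζ = ψ(−τ tr(β t₀))`; the ball is translation-stable by ★ F3c-1 `mball_add`), and the support form `forall_addChar_eq_one_of_setIntegral_ne_zero`: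
  «`W ≠ 0 ⇒ ψ(−τ tr(β t₀)) = 1` for every `t₀ ∈ B(−k)` with `n(t₀) ∈ U`» = «`W = 0` unless `β ∈ Λ_v(U, k)`», locally constant in the level `U`.
HONEST LABEL.  Count-neutral helper; it retires nothing by itself: `HC_CM` is proved only modulo the 7 printed citations (2 remaining named inputs:
hLiu418 = `stmt-HodgeConjecture-24832`, h413 = `stmt-HodgeConjecture-24833`) until rung 0 closes.

## References
* [Casselman1980] W. Casselman, *The unramified principal series of p-adic groups I*, Compositio Math. 40 (1980), §3 (Karel's lemma; lattice support).
* [KudlaRallis1994] S. Kudla, S. Rallis, Ann. of Math. 140 (1994), §2.   * [Shimura1997] G. Shimura, CBMS 93 (1997), §13 (volumes), §18 (local Whittaker integrals).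
* [WeilBNT1967] A. Weil, *Basic Number Theory* (1967), Ch. II §4 (module of a local field, volumes of balls).
* [CasselsFrohlichANT1967] J. W. S. Cassels, A. Fröhlich (eds.), *Algebraic Number Theory* (1967), Ch. II §10 (ultrametric balls in `E ⊗ F_v`).
-/

set_option autoImplicit false
-- the mandated namespace repeats the single-problem summit's segment (`HodgeConjecture.HodgeConjecture`)
set_option linter.dupNamespace false

noncomputable section

open scoped NNReal ENNReal Matrix
open NumberField IsDedekindDomain Matrix MeasureTheory Set
open Literature.NumberTheory.GaloisRepresentations Literature.NumberTheory.GaloisRepresentations.IsNonarchimedeanLocalField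
open Literature.NumberTheory.Automorphic Literature.NumberTheory.Automorphic.UnitaryGroup
open Literature.NumberTheory.GelbartRogawski1991.AdaptedBlocks
open Literature.NumberTheory.GelbartRogawski1991.UnitaryDualPair.LocalSplitting
open Literature.NumberTheory.K2Lit.LocalSiegelDoubled
open Summit.HodgeConjecture.HodgeConjecture.Cruxes.HLiu418.K2LiuLocalRingValuationBalls
open Summit.HodgeConjecture.HodgeConjecture.Cruxes.HLiu418.K2LiuSkewLatticeShells
open Summit.HodgeConjecture.HodgeConjecture.Cruxes.HLiu418.K2LiuSkewBallVolumeGrowth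
open Summit.HodgeConjecture.HodgeConjecture.Cruxes.HLiu418.K2LiuBadPlaceWhittakerHeads
open Summit.HodgeConjecture.HodgeConjecture.Cruxes.HLiu418.K2LiuBadPlaceWhittakerShells

namespace Summit.HodgeConjecture.HodgeConjecture.Cruxes.HLiu418.K2LiuBadPlaceWhittakerSkewInstance

variable (F : Type) [Field F] [NumberField F] (E : Type) [Field E] [NumberField E] [Algebra F E] (c : E ≃ₐ[F] E)
  (v : HeightOneSpectrum (𝓞 F)) {π : v.adicCompletion F} (hπ : Valued.v π = WithZero.exp (-1 : ℤ))
  (n : ℕ) {T₀ : Matrix (Fin n) (Fin n) F}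
  {JD : Matrix (Fin (n + n)) (Fin (n + n)) E} (hJD : JD = (gramD F n T₀).map (algebraMap F E))
  (S : AddSubgroup (Matrix (Fin n) (Fin n) (LocalRing E v)))
  (hS : ∀ t, t ∈ S ↔ (t.map (conjLocal E c v))ᵀ * gramS F E v n T₀ + gramS F E v n T₀ * t = 0)

/-! ## §1 The BOUND in ball-volume letters -/

section Bound

variable [MeasurableSpace S] [BorelSpace S] (μ : Measure S) [μ.IsAddHaarMeasure]

include c hS hπ in
/-- **`‖∫_{B(−k)} φ·ψ(−τ tr(β t)) dμ‖ ≤ C · μ(B(−k))`** for `‖φ‖ ≤ C` on the ball (★ F4b-2 `norm_setIntegral_ball_le` at `V = Skew`; `|ψ| = 1`).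
[cite: Shimura1997, §18] [cite: Casselman1980, §3] -/
theorem norm_setIntegral_ball_mul_addChar_le {φ : S → ℂ} (k : ℤ) {C : ℝ}
    (hC : ∀ t ∈ {t : S | ∀ i j (w : PlacesOver E v), Valued.v (t.1 i j w) ≤ Valued.v (toPlace v w π) ^ (-k)}, ‖φ t‖ ≤ C)
    (ψ : AddChar (v.adicCompletion F) Circle) (τ : LocalRing E v → v.adicCompletion F) (β : Matrix (Fin n) (Fin n) (LocalRing E v)) :
    ‖∫ t in {t : S | ∀ i j (w : PlacesOver E v), Valued.v (t.1 i j w) ≤ Valued.v (toPlace v w π) ^ (-k)},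
        φ t * ((ψ (-τ (Matrix.trace (β * t.1))) : Circle) : ℂ) ∂μ‖ ≤
      C * μ.real {t : S | ∀ i j (w : PlacesOver E v), Valued.v (t.1 i j w) ≤ Valued.v (toPlace v w π) ^ (-k)} :=
  norm_setIntegral_ball_le μ (measure_ball_ne_top F E c v hπ n S hS μ (-k)) hC fun t _ => by rw [Circle.norm_coe]

include hπ in
/-- each factor `|ι_w π|_w⁻¹` of the volume letter `N_v` is finite (`ι_w π ≠ 0`). [cite: WeilBNT1967, Ch. II §4] -/
theorem normAbs_toPlace_uniformizer_ne_zero (w : PlacesOver E v) : normAbs (w.1.adicCompletion E) (toPlace v w π) ≠ 0 := by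
  rw [map_ne_zero (normAbs (w.1.adicCompletion E))]
  intro h
  exact valued_toPlace_uniformizer_ne_zero F E v hπ w (by rw [h, map_zero])

include hπ in
/-- each factor `|ι_w π|_w⁻¹` of `N_v` is `≥ 1` (`ι_w π` is a local integer). [cite: WeilBNT1967, Ch. II §4] -/
theorem normAbs_toPlace_uniformizer_le_one (w : PlacesOver E v) : normAbs (w.1.adicCompletion E) (toPlace v w π) ≤ 1 :=
  (normAbs_le_one_iff (F := w.1.adicCompletion E)).2 ((Valuation.mem_valuationSubring_iff _ _).2
    ((Valuation.vle_one_iff (ValuativeRel.valuation (w.1.adicCompletion E))).1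
      ((Valuation.vle_one_iff (Valued.v : Valuation (w.1.adicCompletion E) (WithZero (Multiplicative ℤ)))).2
        (valued_toPlace_uniformizer_le_one F E v hπ w))))

include hπ in
/-- **the volume letter is finite**: `N_v = ∏_{(i,j,w)} |ι_w π|_w⁻¹ ≠ ∞`. [cite: WeilBNT1967, Ch. II §4] -/
theorem prod_inv_normAbs_ne_top :
    (∏ p : Fin n × Fin n × PlacesOver E v, ((normAbs (p.2.2.1.adicCompletion E) (toPlace v p.2.2 π) : ℝ≥0∞))⁻¹) ≠ ∞ :=
  ENNReal.prod_ne_top fun p _ => ENNReal.inv_ne_top.2 (by exact_mod_cast normAbs_toPlace_uniformizer_ne_zero F E v hπ p.2.2)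

include hπ in
/-- **the volume letter is `≥ 1`**: `1 ≤ N_v` (each factor is). [cite: WeilBNT1967, Ch. II §4] -/
theorem one_le_prod_inv_normAbs :
    1 ≤ (∏ p : Fin n × Fin n × PlacesOver E v, ((normAbs (p.2.2.1.adicCompletion E) (toPlace v p.2.2 π) : ℝ≥0∞))⁻¹) := by
  refine Finset.one_le_prod' fun p _ => ENNReal.one_le_inv.2 ?_
  exact_mod_cast normAbs_toPlace_uniformizer_le_one F E v hπ p.2.2

include hπ in
/-- `1 ≤ N_v` in real numbers. [cite: WeilBNT1967, Ch. II §4] -/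
theorem one_le_toReal_prod_inv_normAbs :
    1 ≤ (∏ p : Fin n × Fin n × PlacesOver E v, ((normAbs (p.2.2.1.adicCompletion E) (toPlace v p.2.2 π) : ℝ≥0∞))⁻¹).toReal := by
  have h := ENNReal.toReal_mono (prod_inv_normAbs_ne_top F E v hπ n) (one_le_prod_inv_normAbs F E v hπ n)
  rwa [ENNReal.toReal_one] at h

include c hS hπ in
/-- **BALL-VOLUME GROWTH in real numbers**: `μ(B(a − K)) ≤ N_v^K · μ(B a)` for every radius `a : ℤ` and `K : ℕ` (★ `measure_ball_sub_le_pow_mul` read in `ℝ`: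
`N_v < ∞` and `μ(B a) < ∞`). [cite: WeilBNT1967, Ch. II §4] [cite: Shimura1997, §13] -/
theorem measureReal_ball_sub_le_pow_mul (a : ℤ) (K : ℕ) :
    μ.real {t : S | ∀ i j (w : PlacesOver E v), Valued.v (t.1 i j w) ≤ Valued.v (toPlace v w π) ^ (a - K)} ≤
      (∏ p : Fin n × Fin n × PlacesOver E v, ((normAbs (p.2.2.1.adicCompletion E) (toPlace v p.2.2 π) : ℝ≥0∞))⁻¹).toReal ^ K *
        μ.real {t : S | ∀ i j (w : PlacesOver E v), Valued.v (t.1 i j w) ≤ Valued.v (toPlace v w π) ^ a} := by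
  have hfin : (∏ p : Fin n × Fin n × PlacesOver E v, ((normAbs (p.2.2.1.adicCompletion E) (toPlace v p.2.2 π) : ℝ≥0∞))⁻¹) ^ K *
      μ {t : S | ∀ i j (w : PlacesOver E v), Valued.v (t.1 i j w) ≤ Valued.v (toPlace v w π) ^ a} ≠ ∞ :=
    ENNReal.mul_ne_top (ENNReal.pow_ne_top (prod_inv_normAbs_ne_top F E v hπ n)) (measure_ball_ne_top F E c v hπ n S hS μ a)
  have h := ENNReal.toReal_mono hfin (measure_ball_sub_le_pow_mul F E c v hπ n S hS μ a K)
  rwa [ENNReal.toReal_mul, ENNReal.toReal_pow] at h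

include c hS hπ in
/-- **THE VOLUME LETTER at radius `0`**: `μ(B(−k)) ≤ N_v^{k⁺} · μ(B 0)` for every `k : ℤ` (`k⁺ = k.toNat`; the previous at `a = 0` for `k ≥ 0`, the balls decrease
for `k < 0`). [cite: WeilBNT1967, Ch. II §4] [cite: Shimura1997, §13] -/
theorem measureReal_ball_neg_le_pow_mul (k : ℤ) :
    μ.real {t : S | ∀ i j (w : PlacesOver E v), Valued.v (t.1 i j w) ≤ Valued.v (toPlace v w π) ^ (-k)} ≤
      (∏ p : Fin n × Fin n × PlacesOver E v, ((normAbs (p.2.2.1.adicCompletion E) (toPlace v p.2.2 π) : ℝ≥0∞))⁻¹).toReal ^ k.toNat *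
        μ.real {t : S | ∀ i j (w : PlacesOver E v), Valued.v (t.1 i j w) ≤ Valued.v (toPlace v w π) ^ (0 : ℤ)} := by
  -- `B(−k) ⊆ B(0 − k⁺)` (equality for `k ≥ 0`, the balls decrease for `k < 0`)
  have hsub : {t : S | ∀ i j (w : PlacesOver E v), Valued.v (t.1 i j w) ≤ Valued.v (toPlace v w π) ^ (-k)} ⊆
      {t : S | ∀ i j (w : PlacesOver E v), Valued.v (t.1 i j w) ≤ Valued.v (toPlace v w π) ^ ((0 : ℤ) - (k.toNat : ℕ))} := by
    refine ball_antitone F E v hπ n S ?_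
    rw [zero_sub, neg_le_neg_iff]
    exact Int.self_le_toNat k
  exact (measureReal_mono hsub (measure_ball_ne_top F E c v hπ n S hS μ _)).trans (measureReal_ball_sub_le_pow_mul F E c v hπ n S hS μ 0 k.toNat)

include c hS hπ in
/-- **THE BOUND, VOLUME FORM**: `‖∫_{B(−k)} φ·ψ(−τ tr(β t)) dμ‖ ≤ C · N_v^{k⁺} · μ(B 0)`. [cite: Shimura1997, §18] [cite: WeilBNT1967, Ch. II §4] -/
theorem norm_setIntegral_ball_mul_addChar_le_pow_mul {φ : S → ℂ} (k : ℤ) {C : ℝ}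
    (hC : ∀ t ∈ {t : S | ∀ i j (w : PlacesOver E v), Valued.v (t.1 i j w) ≤ Valued.v (toPlace v w π) ^ (-k)}, ‖φ t‖ ≤ C)
    (ψ : AddChar (v.adicCompletion F) Circle) (τ : LocalRing E v → v.adicCompletion F) (β : Matrix (Fin n) (Fin n) (LocalRing E v)) :
    ‖∫ t in {t : S | ∀ i j (w : PlacesOver E v), Valued.v (t.1 i j w) ≤ Valued.v (toPlace v w π) ^ (-k)},
        φ t * ((ψ (-τ (Matrix.trace (β * t.1))) : Circle) : ℂ) ∂μ‖ ≤
      C * ((∏ p : Fin n × Fin n × PlacesOver E v, ((normAbs (p.2.2.1.adicCompletion E) (toPlace v p.2.2 π) : ℝ≥0∞))⁻¹).toReal ^ k.toNat *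
        μ.real {t : S | ∀ i j (w : PlacesOver E v), Valued.v (t.1 i j w) ≤ Valued.v (toPlace v w π) ^ (0 : ℤ)}) := by
  have hC0 : 0 ≤ C := (norm_nonneg _).trans (hC 0 (zero_mem_ball F E v n S (-k)))
  exact (norm_setIntegral_ball_mul_addChar_le F E c v hπ n S hS μ k hC ψ τ β).trans
    (mul_le_mul_of_nonneg_left (measureReal_ball_neg_le_pow_mul F E c v hπ n S hS μ k) hC0)

/-- exponent bookkeeping: `(K₁ + 4b + 2b′ − 1)⁺ ≤ K₁⁺ + 4b⁺ + 2b′⁺`. [folklore] -/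
theorem toNat_exponent_le (K₁ b b' : ℤ) : (K₁ + 4 * b + 2 * b' - 1).toNat ≤ K₁.toNat + 4 * b.toNat + 2 * b'.toNat := by
  have h1 := Int.self_le_toNat K₁
  have h2 := Int.self_le_toNat b
  have h3 := Int.self_le_toNat b'
  omega

/-- `N^{(K₁ + 4b + 2b′ − 1)⁺} ≤ N^{K₁⁺} · (N^4)^{b⁺} · (N^2)^{b′⁺}` for `1 ≤ N`. [folklore] -/
theorem pow_toNat_exponent_le {N : ℝ} (hN : 1 ≤ N) (K₁ b b' : ℤ) :
    N ^ (K₁ + 4 * b + 2 * b' - 1).toNat ≤ N ^ K₁.toNat * (N ^ 4) ^ b.toNat * (N ^ 2) ^ b'.toNat := by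
  rw [← pow_mul, ← pow_mul, ← pow_add, ← pow_add]
  exact pow_le_pow_right₀ hN (by have := toNat_exponent_le K₁ b b'; omega)

include c hS hπ in
/-- **THE BOUND AT THE Φ5 TRUNCATION EXPONENT, (A-1) SHAPE.**  At `k = K₁ + 4b + 2b′ − 1` (the exponent of ★ Φ5-tie `whittaker_setIntegral_ball_eq`: `β ∈ ball(−b)`,
`β⁻¹ ∈ ball(−b′)`): `‖∫_{B(−k)} φ·ψ(−τ tr(β t)) dμ‖ ≤ C · N_v^{K₁⁺} · (N_v^4)^{b⁺} · (N_v^2)^{b′⁺} · μ(B 0)` — the local constant `C · N_v^{K₁⁺} · μ(B 0)` times a weight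
polynomial in `q_v^{b}`, `q_v^{b′}` (`= |det β|_v^{−A}(1+‖β‖_v)^{A}` in valuation letters; NOT uniform in `β`, M-156n (A-1)). [cite: Shimura1997, §18] [cite: Casselman1980, §3] -/
theorem norm_setIntegral_ball_mul_addChar_le_of_exponent {φ : S → ℂ} (K₁ b b' : ℤ) {C : ℝ}
    (hC : ∀ t ∈ {t : S | ∀ i j (w : PlacesOver E v), Valued.v (t.1 i j w) ≤ Valued.v (toPlace v w π) ^ (-(K₁ + 4 * b + 2 * b' - 1))}, ‖φ t‖ ≤ C)
    (ψ : AddChar (v.adicCompletion F) Circle) (τ : LocalRing E v → v.adicCompletion F) (β : Matrix (Fin n) (Fin n) (LocalRing E v)) :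
    ‖∫ t in {t : S | ∀ i j (w : PlacesOver E v), Valued.v (t.1 i j w) ≤ Valued.v (toPlace v w π) ^ (-(K₁ + 4 * b + 2 * b' - 1))},
        φ t * ((ψ (-τ (Matrix.trace (β * t.1))) : Circle) : ℂ) ∂μ‖ ≤
      C * ((∏ p : Fin n × Fin n × PlacesOver E v, ((normAbs (p.2.2.1.adicCompletion E) (toPlace v p.2.2 π) : ℝ≥0∞))⁻¹).toReal ^ K₁.toNat *
        ((∏ p : Fin n × Fin n × PlacesOver E v, ((normAbs (p.2.2.1.adicCompletion E) (toPlace v p.2.2 π) : ℝ≥0∞))⁻¹).toReal ^ 4) ^ b.toNat *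
        ((∏ p : Fin n × Fin n × PlacesOver E v, ((normAbs (p.2.2.1.adicCompletion E) (toPlace v p.2.2 π) : ℝ≥0∞))⁻¹).toReal ^ 2) ^ b'.toNat *
        μ.real {t : S | ∀ i j (w : PlacesOver E v), Valued.v (t.1 i j w) ≤ Valued.v (toPlace v w π) ^ (0 : ℤ)}) := by
  have hC0 : 0 ≤ C := (norm_nonneg _).trans (hC 0 (zero_mem_ball F E v n S _))
  refine (norm_setIntegral_ball_mul_addChar_le_pow_mul F E c v hπ n S hS μ (K₁ + 4 * b + 2 * b' - 1) hC ψ τ β).trans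
    (mul_le_mul_of_nonneg_left ?_ hC0)
  exact mul_le_mul_of_nonneg_right (pow_toNat_exponent_le (one_le_toReal_prod_inv_normAbs F E v hπ n) K₁ b b') measureReal_nonneg

end Bound

/-! ## §2 The LATTICE SUPPORT -/

section Support

variable [MeasurableSpace S] [BorelSpace S] (μ : Measure S) [μ.IsAddRightInvariant]

omit [MeasurableSpace S] [BorelSpace S] in
/-- the character weight `χ(t) = ψ(−τ tr(β t))` is multiplicative under translation: `χ(t + t₀) = χ(t₀)·χ(t)` (`τ` additive). [cite: Shimura1997, §18] -/
theorem addChar_neg_trace_mul_add (ψ : AddChar (v.adicCompletion F) Circle) {τ : LocalRing E v → v.adicCompletion F}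
    (hτadd : ∀ r s, τ (r + s) = τ r + τ s) (β : Matrix (Fin n) (Fin n) (LocalRing E v)) (t t₀ : S) :
    ((ψ (-τ (Matrix.trace (β * (t + t₀).1))) : Circle) : ℂ) =
      ((ψ (-τ (Matrix.trace (β * t₀.1))) : Circle) : ℂ) * ((ψ (-τ (Matrix.trace (β * t.1))) : Circle) : ℂ) := by
  rw [AddSubgroup.coe_add, Matrix.mul_add, Matrix.trace_add, hτadd, neg_add, AddChar.map_add_eq_mul, Circle.coe_mul, mul_comm]

omit [MeasurableSpace S] [BorelSpace S] in
/-- the ball `B(−k)` is stable under translation by its elements (★ F3c-1 `mball_add`, `ball_neg`). [cite: CasselsFrohlichANT1967, Ch. II §10] -/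
theorem add_mem_ball_iff (k : ℤ) {t₀ : S}
    (ht₀ : t₀ ∈ {t : S | ∀ i j (w : PlacesOver E v), Valued.v (t.1 i j w) ≤ Valued.v (toPlace v w π) ^ (-k)}) (t : S) :
    t + t₀ ∈ {t : S | ∀ i j (w : PlacesOver E v), Valued.v (t.1 i j w) ≤ Valued.v (toPlace v w π) ^ (-k)} ↔
      t ∈ {t : S | ∀ i j (w : PlacesOver E v), Valued.v (t.1 i j w) ≤ Valued.v (toPlace v w π) ^ (-k)} := by
  have hneg : ∀ i j (w : PlacesOver E v), Valued.v ((-t₀).1 i j w) ≤ Valued.v (toPlace v w π) ^ (-k) := fun i j w => by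
    rw [AddSubgroup.coe_neg, Matrix.neg_apply, Pi.neg_apply, Valuation.map_neg]
    exact ht₀ i j w
  constructor
  · intro h
    have h' := mball_add F E v (X := (t + t₀).1) (Y := (-t₀).1) h hneg
    have heq : (t + t₀).1 + (-t₀).1 = t.1 := by rw [AddSubgroup.coe_add, AddSubgroup.coe_neg, add_neg_cancel_right]
    rw [heq] at h'
    exact h'
  · intro h
    have h' := mball_add F E v (X := t.1) (Y := t₀.1) h ht₀
    exact fun i j w => by rw [AddSubgroup.coe_add]; exact h' i j w

include hJD hπ in
/-- **LATTICE SUPPORT.**  If some `t₀ ∈ B(−k)` with `n(t₀) ∈ U` (the right-invariance group of `f`) has `ψ(−τ tr(β t₀)) ≠ 1`, then the ball integral vanishes: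
`∫_{B(−k)} f(w_Δ n(t))·ψ(−τ tr(β t)) dμ = 0` (★ F4a `setIntegral_eq_zero_of_unipotent_translate` with `χ = ψ(−τ tr(β·))`, `ζ = ψ(−τ tr(β t₀))`) — the bad-place local
Whittaker coefficient is supported on the `β` pairing trivially (through `ψ ∘ τ ∘ tr`) with the level lattice `{t₀ ∈ B(−k) | n(t₀) ∈ U}`. [cite: Casselman1980, §3] [cite: Shimura1997, §18] -/
theorem setIntegral_ball_whittaker_eq_zero_of_translate
    {f : UnitaryGroup.localPi E c (n + n) JD v → ℂ} {U : Subgroup (UnitaryGroup.localPi E c (n + n) JD v)} (hfU : ∀ g u, u ∈ U → f (g * u) = f g)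
    (ψ : AddChar (v.adicCompletion F) Circle) {τ : LocalRing E v → v.adicCompletion F} (hτadd : ∀ r s, τ (r + s) = τ r + τ s)
    (β : Matrix (Fin n) (Fin n) (LocalRing E v)) (k : ℤ) {t₀ : S}
    (ht₀ : t₀ ∈ {t : S | ∀ i j (w : PlacesOver E v), Valued.v (t.1 i j w) ≤ Valued.v (toPlace v w π) ^ (-k)})
    (ht₀U : nElem F E c v n hJD t₀.1 ((hS t₀.1).1 t₀.2) ∈ U) (hne : ψ (-τ (Matrix.trace (β * t₀.1))) ≠ 1) :
    ∫ t in {t : S | ∀ i j (w : PlacesOver E v), Valued.v (t.1 i j w) ≤ Valued.v (toPlace v w π) ^ (-k)},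
        f (weylDelta F E c v n hJD * nElem F E c v n hJD t.1 ((hS t.1).1 t.2)) * ((ψ (-τ (Matrix.trace (β * t.1))) : Circle) : ℂ) ∂μ = 0 :=
  setIntegral_eq_zero_of_unipotent_translate F E c v n hJD S hS μ hfU ht₀U
    (χ := fun t : S => ((ψ (-τ (Matrix.trace (β * t.1))) : Circle) : ℂ)) (ζ := ((ψ (-τ (Matrix.trace (β * t₀.1))) : Circle) : ℂ))
    (fun t => addChar_neg_trace_mul_add F E v n S ψ hτadd β t t₀) (fun h => hne (Circle.coe_eq_one.1 h))
    (measurableSet_ball F E v hπ n S (-k)) (add_mem_ball_iff F E v n S k ht₀)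

include hJD hπ in
/-- **SUPPORT FORM**: if the ball integral is non-zero then `ψ(−τ tr(β t₀)) = 1` for EVERY `t₀ ∈ B(−k)` with `n(t₀) ∈ U` — «`W_{β,v}(f) = 0` unless `β` lies in the dual
lattice `Λ_v(U, k)`», a condition locally constant in the level `U`. [cite: Casselman1980, §3] [cite: Shimura1997, §18] -/
theorem forall_addChar_eq_one_of_setIntegral_ne_zero
    {f : UnitaryGroup.localPi E c (n + n) JD v → ℂ} {U : Subgroup (UnitaryGroup.localPi E c (n + n) JD v)} (hfU : ∀ g u, u ∈ U → f (g * u) = f g)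
    (ψ : AddChar (v.adicCompletion F) Circle) {τ : LocalRing E v → v.adicCompletion F} (hτadd : ∀ r s, τ (r + s) = τ r + τ s)
    (β : Matrix (Fin n) (Fin n) (LocalRing E v)) (k : ℤ)
    (hW : ∫ t in {t : S | ∀ i j (w : PlacesOver E v), Valued.v (t.1 i j w) ≤ Valued.v (toPlace v w π) ^ (-k)},
        f (weylDelta F E c v n hJD * nElem F E c v n hJD t.1 ((hS t.1).1 t.2)) * ((ψ (-τ (Matrix.trace (β * t.1))) : Circle) : ℂ) ∂μ ≠ 0) :
    ∀ t₀ : S, t₀ ∈ {t : S | ∀ i j (w : PlacesOver E v), Valued.v (t.1 i j w) ≤ Valued.v (toPlace v w π) ^ (-k)} →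
      nElem F E c v n hJD t₀.1 ((hS t₀.1).1 t₀.2) ∈ U → ψ (-τ (Matrix.trace (β * t₀.1))) = 1 := by
  intro t₀ ht₀ ht₀U
  by_contra hne
  exact hW (setIntegral_ball_whittaker_eq_zero_of_translate F E c v hπ n hJD S hS μ hfU ψ hτadd β k ht₀ ht₀U hne)

end Support

end Summit.HodgeConjecture.HodgeConjecture.Cruxes.HLiu418.K2LiuBadPlaceWhittakerSkewInstance

end
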